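import Literature.NumberTheory.LFunctions.SmoothedExplicitFormulaContour
import HarnessLib

/-!
# Selberg's explicit formula for `ζ'/ζ` with the weights `Λ_x` (cubic kernel)

Topic `Literature/NumberTheory/LFunctions`. Everything in this file is PROVED (definitions with
bodies and theorems; no named facts).

A. Selberg, *Contributions to the theory of the Riemann zeta-function* (1946), §2, introduced the
weights (`x > 1`, `ℓ = log x`)

  `Λ_x(n) = Λ(n)` (`n ≤ x`), `Λ(n) (log²(x³/n) − 2 log²(x²/n))/(2ℓ²)` (`x ≤ n ≤ x²`),
  `Λ(n) log²(x³/n)/(2ℓ²)` (`x² ≤ n ≤ x³`), `0` (`n ≥ x³`),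

i.e. `Λ_x(n) = Λ(n) f_ℓ(log n)` with the `C¹` piecewise-quadratic smoothing
`f_ℓ(u) = ((ℓ−u)₊² − 2(2ℓ−u)₊² + (3ℓ−u)₊²)/(2ℓ²)` (`Literature.NumberTheory.LFunctions.SelbergExplicit.smoothing`),
and proved the explicit formula ("a similar formula where the sum over zeros has a factor of
`(s − ρ)³` in the denominator", Goldston, *Notes on pair correlation of zeros and prime numbers*,
§10, after (10.18); the quadratic-kernel version is Titchmarsh's Theorem 14.20):

  `ζ'/ζ(s) = − Σ_{n < x³} Λ_x(n) n^{−s} − x^{1−s}(1 − x^{1−s})²/(ℓ²(s−1)³)`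
  `          + (1/ℓ²) Σ_ρ m(ρ) x^{ρ−s}(1 − x^{ρ−s})²/(s−ρ)³ + J_x(s)`,

the sum over the non-trivial zeros `ρ` of `ζ` with multiplicity `m(ρ)`, absolutely convergent, and
`J_x(s)` the contribution of the trivial zeros / the left line. Here it is obtained from the tree's
exact smoothed explicit formula of Ford–Kadiri–Heath-Brown (`SmoothedEF.fordK_eq_explicit`,
`SmoothedExplicitFormulaContour.lean`: `K_f(s) = −f(0)ζ'/ζ(s) + F₀(s−1) − Σ_ρ m(ρ)F₀(s−ρ) + J_f(s)`
for `−1/2 < Re s < 3/2`) applied to the three admissible one-piece smoothings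
`g_a(u) = (a − u)₊²`, `a = ℓ, 2ℓ, 3ℓ` (`Literature.NumberTheory.LFunctions.SelbergExplicit.quadPiece`), whose
transforms are elementary: `F₀(z) = −2a/z² + 2/z³ − 2e^{−az}/z³`
(`Literature.NumberTheory.LFunctions.SelbergExplicit.fordLaplace₀_quadPiece`), so that the combination
`g_ℓ − 2g_{2ℓ} + g_{3ℓ} = 2ℓ² f_ℓ` has `F₀(z) = −2e^{−ℓz}(1 − e^{−ℓz})²/z³`.

Main statements (namespace `Literature.NumberTheory.LFunctions.SelbergExplicit`):

* `smoothing`, `smoothing_eq_one` (`u ≤ ℓ`), `smoothing_eq_zero` (`3ℓ ≤ u`), `smoothing_nonneg`,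
  `smoothing_le_one`;
* `zeroTerm ℓ s ρ = e^{(ρ−s)ℓ}(1 − e^{(ρ−s)ℓ})²/(ℓ²(s−ρ)³)` and `remainder ℓ s` (the left-line
  integral, `= (J_{g_ℓ} − 2J_{g_{2ℓ}} + J_{g_{3ℓ}})/(2ℓ²)`);
* `summable_norm_zeroTerm` — absolute convergence of `Σ_ρ m(ρ) zeroTerm ℓ s ρ`;
* `explicit_formula` — **Selberg's formula**: for `0 < ℓ`, `−1/2 < Re s < 3/2`, `s ≠ 1`, `ζ(s) ≠ 0`,
  `ζ'/ζ(s) = −K_{f_ℓ}(s) − zeroTerm ℓ s 1 + Σ_ρ m(ρ) zeroTerm ℓ s ρ + remainder ℓ s`, where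
  `K_{f_ℓ}(s) = Σ Λ(n) f_ℓ(log n) n^{−s}` (`fordK`, a finite sum: `fordK_smoothing_eq_sum`);
* `norm_remainder_le` — `‖remainder ℓ s‖ ≤ C (1 + log(1+|Im s|)) e^{−ℓ(Re s + 1/2)}/ℓ²` for
  `0 < ℓ`, `1/2 ≤ Re s`, with an absolute constant `C`;
* `norm_logDeriv_add_fordK_le` — to the right of `1` no explicit formula is needed:
  `‖ζ'/ζ(s) + K_{f_ℓ}(s)‖ ≤ e^{−ℓ(Re s − σ₀)} Σ Λ(n) n^{−σ₀}` for `1 < σ₀ ≤ Re s`.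

This is the first step of the in-tree proof of Selberg's unconditional approximate formula for
`S(t)` (Titchmarsh §14.21 without RH; programme recorded in `SelbergFujiiApproxFormula.lean`).

## References

* A. Selberg, *Contributions to the theory of the Riemann zeta-function*, Arch. Math. Naturvid. 48
  (1946) no. 5, 89–155, §2. [cite: Titchmarsh1986, Thm. 14.20 (quadratic kernel); §14.35]
* E. C. Titchmarsh, *The Theory of the Riemann Zeta-Function*, 2nd ed. (1986), Theorem 14.20
  (p. 345 of the held copy).
* D. A. Goldston, *Notes on pair correlation of zeros and prime numbers*, in: Recent Perspectives
  in Random Matrix Theory and Number Theory, LMS Lecture Note Ser. 322 (2005), §10, (10.11)–(10.18).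
* K. Ford, *Zero-free regions for the Riemann zeta function* (2002), Lemma 4.5 (the tree's
  `SmoothedEF.fordK_eq_explicit`).
-/

noncomputable section

open Complex Real MeasureTheory Set Filter Topology

namespace Literature.NumberTheory.LFunctions

namespace SelbergExplicit

/-! ## The one-piece quadratic smoothings `g_a(u) = (a − u)₊²` -/

/-- `g_a(u) = (max(a − u, 0))²`: equal to `(a − u)²` for `u ≤ a` and to `0` for `u ≥ a`. [folklore] -/
def quadPiece (a : ℝ) (u : ℝ) : ℝ := (max (a - u) 0) ^ 2

/-- `g_a(u) = (a−u)²` for `u ≤ a`. [folklore] -/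
theorem quadPiece_of_le {a u : ℝ} (h : u ≤ a) : quadPiece a u = (a - u) ^ 2 := by
  rw [quadPiece, max_eq_left (by linarith)]

/-- `g_a(u) = 0` for `u ≥ a`. [folklore] -/
theorem quadPiece_of_ge {a u : ℝ} (h : a ≤ u) : quadPiece a u = 0 := by
  rw [quadPiece, max_eq_right (by linarith)]; ring

/-- `g_a(0) = a²` (`a ≥ 0`). [folklore] -/
theorem quadPiece_zero (a : ℝ) (ha : 0 ≤ a) : quadPiece a 0 = a ^ 2 := by
  rw [quadPiece_of_le ha, sub_zero]

/-- `g_a ≥ 0`. [folklore] -/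
theorem quadPiece_nonneg (a u : ℝ) : 0 ≤ quadPiece a u := sq_nonneg _

/-- `g_a` is continuous. [folklore] -/
theorem continuous_quadPiece (a : ℝ) : Continuous (quadPiece a) := by
  unfold quadPiece; fun_prop

/-- `g_a` is an admissible smoothing for the exact explicit formula (`p(u) = (a−u)²` on `[0, a]`,
`p(a) = p'(a) = 0`). [folklore] -/
theorem isSmoothedEFTest_quadPiece {a : ℝ} (ha : 0 ≤ a) :
    IsSmoothedEFTest (quadPiece a) (fun u ↦ (a - u) ^ 2) (fun u ↦ -(2 * (a - u))) (fun _ ↦ 2) a where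
  cont := continuous_quadPiece a
  x₀_nonneg := ha
  eqOn := fun t ht ↦ quadPiece_of_le ht.2
  eq_zero := fun u hu ↦ quadPiece_of_ge hu
  hasDerivAt := fun t ↦ by
    have h1 : HasDerivAt (fun u : ℝ ↦ a - u) (-1) t := by
      simpa using (hasDerivAt_id t).const_sub a
    have h2 := h1.mul h1
    have hf : (fun u : ℝ ↦ (a - u) ^ 2) = fun u ↦ (a - u) * (a - u) := by funext u; ring
    rw [hf]
    exact h2.congr_deriv (by ring)
  hasDerivAt' := fun t ↦ by
    have h1 : HasDerivAt (fun u : ℝ ↦ a - u) (-1) t := by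
      simpa using (hasDerivAt_id t).const_sub a
    have h2 := (h1.const_mul 2).neg
    exact h2.congr_deriv (by ring)
  cont'' := continuous_const
  p_x₀ := by simp
  p'_x₀ := by simp

/-! ## The Laplace transforms in closed form -/

/-- An antiderivative of `(a − t)² e^{−zt}` (`z ≠ 0`). [folklore] -/
theorem hasDerivAt_quadPiece_primitive (a : ℝ) {z : ℂ} (hz : z ≠ 0) (t : ℝ) :
    HasDerivAt (fun t : ℝ ↦ -Complex.exp (-(z * t)) *
        (((a : ℂ) - t) * ((a : ℂ) - t) / z - 2 * ((a : ℂ) - t) / z ^ 2 + 2 / z ^ 3))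
      ((((a - t) ^ 2 : ℝ) : ℂ) * Complex.exp (-(z * t))) t := by
  have he : HasDerivAt (fun t : ℝ ↦ Complex.exp (-(z * t))) (Complex.exp (-(z * t)) * (-z)) t := by
    have h1 : HasDerivAt (fun t : ℝ ↦ -(z * t)) (-z) t := by
      have := ((hasDerivAt_id (t : ℂ)).const_mul z).neg
      simpa using this.comp_ofReal
    exact h1.cexp
  have hl : HasDerivAt (fun t : ℝ ↦ (a : ℂ) - t) (-1) t := by
    simpa using ((hasDerivAt_id (t : ℂ)).const_sub (a : ℂ)).comp_ofReal
  have hp : HasDerivAt (fun t : ℝ ↦ ((a : ℂ) - t) * ((a : ℂ) - t) / z - 2 * ((a : ℂ) - t) / z ^ 2 + 2 / z ^ 3)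
      ((-1 * ((a : ℂ) - t) + ((a : ℂ) - t) * (-1)) / z - 2 * (-1) / z ^ 2 + 0) t :=
    (((hl.mul hl).div_const z).sub ((hl.const_mul 2).div_const (z ^ 2))).add (hasDerivAt_const t _)
  have he' : HasDerivAt (fun t : ℝ ↦ -Complex.exp (-(z * t))) (-(Complex.exp (-(z * t)) * (-z))) t :=
    he.neg
  have h := he'.mul hp
  refine h.congr_deriv ?_
  push_cast
  field_simp
  ring

/-- `F(z) = ∫₀^a (a−t)² e^{−zt} dt = a²/z − 2a/z² + 2/z³ − 2e^{−az}/z³` for the smoothing `g_a`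
(`a ≥ 0`, `z ≠ 0`). [folklore] -/
theorem fordLaplace_quadPiece {a : ℝ} (ha : 0 ≤ a) {z : ℂ} (hz : z ≠ 0) :
    fordLaplace (quadPiece a) z =
      (a : ℂ) ^ 2 / z - 2 * (a : ℂ) / z ^ 2 + 2 / z ^ 3 - 2 * Complex.exp (-(z * a)) / z ^ 3 := by
  have h := isSmoothedEFTest_quadPiece ha
  rw [fordLaplace_eq_intervalIntegral ha h.eqOn h.eq_zero (by fun_prop) z]
  have hint := intervalIntegral.integral_eq_sub_of_hasDerivAt (a := 0) (b := a)
    (f := fun t : ℝ ↦ -Complex.exp (-(z * t)) *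
        (((a : ℂ) - t) * ((a : ℂ) - t) / z - 2 * ((a : ℂ) - t) / z ^ 2 + 2 / z ^ 3))
    (f' := fun t : ℝ ↦ (((a - t) ^ 2 : ℝ) : ℂ) * Complex.exp (-(z * t)))
    (fun t _ ↦ hasDerivAt_quadPiece_primitive a hz t)
    (by
      apply Continuous.intervalIntegrable
      fun_prop)
  have heq : (∫ t in (0 : ℝ)..a, (((fun u : ℝ ↦ (a - u) ^ 2) t : ℝ) : ℂ) * Complex.exp (-(z * t))) =
      ∫ t in (0 : ℝ)..a, (((a - t) ^ 2 : ℝ) : ℂ) * Complex.exp (-(z * t)) := rfl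
  rw [heq, hint]
  simp only [Complex.ofReal_zero, sub_zero, mul_zero, neg_zero, Complex.exp_zero]
  field_simp
  ring

/-- `F₀(z) = F(z) − g_a(0)/z = −2a/z² + 2/z³ − 2e^{−az}/z³` for `g_a` (`a ≥ 0`, `z ≠ 0`). [folklore] -/
theorem fordLaplace₀_quadPiece {a : ℝ} (ha : 0 ≤ a) {z : ℂ} (hz : z ≠ 0) :
    fordLaplace₀ (quadPiece a) z =
      -(2 * (a : ℂ)) / z ^ 2 + 2 / z ^ 3 - 2 * Complex.exp (-(z * a)) / z ^ 3 := by
  rw [fordLaplace₀, fordLaplace_quadPiece ha hz, quadPiece_zero a ha]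
  push_cast
  field_simp
  ring

/-! ## Selberg's smoothing `f_ℓ` and the weights `Λ_x(n) = Λ(n) f_ℓ(log n)` -/

/-- **Selberg's smoothing** `f_ℓ(u) = ((ℓ−u)₊² − 2(2ℓ−u)₊² + (3ℓ−u)₊²)/(2ℓ²)`, so that
`Λ(n) f_ℓ(log n) = Λ_x(n)` (`x = e^ℓ`) are Selberg's weights: `f_ℓ = 1` on `(−∞, ℓ]`,
`= 1 − (u−ℓ)²/(2ℓ²)` on `[ℓ, 2ℓ]`, `= (3ℓ−u)²/(2ℓ²)` on `[2ℓ, 3ℓ]`, `= 0` on `[3ℓ, ∞)`.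
[cite: Titchmarsh1986, Thm. 14.20 (two-piece analogue)] -/
def smoothing (ℓ : ℝ) (u : ℝ) : ℝ :=
  (quadPiece ℓ u - 2 * quadPiece (2 * ℓ) u + quadPiece (3 * ℓ) u) / (2 * ℓ ^ 2)

/-- `f_ℓ(u) = 1` for `u ≤ ℓ` (i.e. `Λ_x(n) = Λ(n)` for `n ≤ x`). [cite: Titchmarsh1986, Thm. 14.20] -/
theorem smoothing_eq_one {ℓ u : ℝ} (hℓ : 0 < ℓ) (hu : u ≤ ℓ) : smoothing ℓ u = 1 := by
  rw [smoothing, quadPiece_of_le hu, quadPiece_of_le (by linarith), quadPiece_of_le (by linarith)]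
  field_simp
  ring

/-- `f_ℓ(u) = (2ℓ² − (u−ℓ)²)/(2ℓ²)` on `[ℓ, 2ℓ]`. [folklore] -/
theorem smoothing_of_mem_Icc {ℓ u : ℝ} (h1 : ℓ ≤ u) (h2 : u ≤ 2 * ℓ) :
    smoothing ℓ u = (2 * ℓ ^ 2 - (u - ℓ) ^ 2) / (2 * ℓ ^ 2) := by
  rw [smoothing, quadPiece_of_ge h1, quadPiece_of_le h2, quadPiece_of_le (by linarith)]
  ring

/-- `f_ℓ(u) = (3ℓ−u)²/(2ℓ²)` on `[2ℓ, 3ℓ]`. [folklore] -/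
theorem smoothing_of_mem_Icc' {ℓ u : ℝ} (h1 : 2 * ℓ ≤ u) (h2 : u ≤ 3 * ℓ) :
    smoothing ℓ u = (3 * ℓ - u) ^ 2 / (2 * ℓ ^ 2) := by
  have h0 : ℓ ≤ u := by nlinarith [sq_nonneg ℓ, sq_nonneg (u - 2 * ℓ)]
  rw [smoothing, quadPiece_of_ge (by linarith : ℓ ≤ u), quadPiece_of_ge h1, quadPiece_of_le h2]
  ring

/-- `f_ℓ(u) = 0` for `u ≥ 3ℓ` (i.e. `Λ_x(n) = 0` for `n ≥ x³`). [folklore] -/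
theorem smoothing_eq_zero {ℓ u : ℝ} (hℓ : 0 ≤ ℓ) (hu : 3 * ℓ ≤ u) : smoothing ℓ u = 0 := by
  rw [smoothing, quadPiece_of_ge (by linarith), quadPiece_of_ge (by linarith), quadPiece_of_ge hu]
  ring

/-- `0 ≤ f_ℓ`. [folklore] -/
theorem smoothing_nonneg {ℓ : ℝ} (hℓ : 0 < ℓ) (u : ℝ) : 0 ≤ smoothing ℓ u := by
  rcases le_or_gt u ℓ with h | h
  · rw [smoothing_eq_one hℓ h]; exact zero_le_one
  rcases le_or_gt u (2 * ℓ) with h' | h'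
  · rw [smoothing_of_mem_Icc h.le h']
    exact div_nonneg (by nlinarith) (by positivity)
  rcases le_or_gt u (3 * ℓ) with h'' | h''
  · rw [smoothing_of_mem_Icc' h'.le h'']; positivity
  · rw [smoothing_eq_zero hℓ.le h''.le]

/-- `f_ℓ ≤ 1`. [folklore] -/
theorem smoothing_le_one {ℓ : ℝ} (hℓ : 0 < ℓ) (u : ℝ) : smoothing ℓ u ≤ 1 := by
  rcases le_or_gt u ℓ with h | h
  · rw [smoothing_eq_one hℓ h]
  rcases le_or_gt u (2 * ℓ) with h' | h'
  · rw [smoothing_of_mem_Icc h.le h', div_le_one (by positivity)]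
    nlinarith
  rcases le_or_gt u (3 * ℓ) with h'' | h''
  · rw [smoothing_of_mem_Icc' h'.le h'', div_le_one (by positivity)]
    nlinarith
  · rw [smoothing_eq_zero hℓ.le h''.le]; exact zero_le_one

/-- `|f_ℓ| ≤ 1`. [folklore] -/
theorem abs_smoothing_le_one {ℓ : ℝ} (hℓ : 0 < ℓ) (u : ℝ) : |smoothing ℓ u| ≤ 1 := by
  rw [abs_of_nonneg (smoothing_nonneg hℓ u)]; exact smoothing_le_one hℓ u

/-- `f_ℓ` is continuous. [folklore] -/
theorem continuous_smoothing (ℓ : ℝ) : Continuous (smoothing ℓ) := by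
  unfold smoothing
  have := continuous_quadPiece ℓ
  have := continuous_quadPiece (2 * ℓ)
  have := continuous_quadPiece (3 * ℓ)
  fun_prop

/-- `K_{f_ℓ}(s) = Σ_{n < N} Λ(n) f_ℓ(log n) n^{−s}` for any `N ≥ 1` with `3ℓ ≤ log N` (a finite
Dirichlet polynomial: `Λ_x(n) = 0` for `n ≥ x³`). [folklore] -/
theorem fordK_smoothing_eq_sum {ℓ : ℝ} (hℓ : 0 ≤ ℓ) {N : ℕ} (hN : 1 ≤ N) (hx : 3 * ℓ ≤ Real.log N)
    (s : ℂ) :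
    fordK (smoothing ℓ) s = ∑ n ∈ Finset.range N,
      ((ArithmeticFunction.vonMangoldt n : ℝ) : ℂ) * (smoothing ℓ (Real.log n) : ℂ) * (n : ℂ) ^ (-s) :=
  fordK_eq_sum (fun _ hu ↦ smoothing_eq_zero hℓ hu) hN hx s

/-- Linearity: `2ℓ² K_{f_ℓ} = K_{g_ℓ} − 2K_{g_{2ℓ}} + K_{g_{3ℓ}}`. [folklore] -/
theorem fordK_smoothing_eq {ℓ : ℝ} (hℓ : 0 < ℓ) (s : ℂ) :
    2 * (ℓ : ℂ) ^ 2 * fordK (smoothing ℓ) s =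
      fordK (quadPiece ℓ) s - 2 * fordK (quadPiece (2 * ℓ)) s + fordK (quadPiece (3 * ℓ)) s := by
  -- a common cut-off `N` with `3ℓ ≤ log N`
  obtain ⟨N, hN⟩ : ∃ N : ℕ, Real.exp (3 * ℓ) ≤ N := exists_nat_ge _
  have hN1 : 1 ≤ N := by
    have : (0 : ℝ) < N := (Real.exp_pos _).trans_le hN
    exact_mod_cast this
  have hlog : 3 * ℓ ≤ Real.log N := by
    rw [Real.le_log_iff_exp_le (by exact_mod_cast hN1)]; exact hN
  rw [fordK_smoothing_eq_sum hℓ.le hN1 hlog,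
    fordK_eq_sum (fun _ hu ↦ quadPiece_of_ge hu) hN1 (by linarith) s,
    fordK_eq_sum (fun _ hu ↦ quadPiece_of_ge hu) hN1 (by linarith) s,
    fordK_eq_sum (fun _ hu ↦ quadPiece_of_ge hu) hN1 hlog s,
    Finset.mul_sum, Finset.mul_sum, ← Finset.sum_sub_distrib, ← Finset.sum_add_distrib]
  refine Finset.sum_congr rfl fun n _ ↦ ?_
  have hℓC : (ℓ : ℂ) ≠ 0 := Complex.ofReal_ne_zero.2 hℓ.ne'
  simp only [smoothing]
  push_cast
  field_simp

/-! ## The kernel, the combination of the three transforms -/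

/-- The term of one zero (or of the pole, `ρ = 1`) in Selberg's formula:
`x^{ρ−s}(1 − x^{ρ−s})²/(ℓ²(s−ρ)³)` with `x^{ρ−s} = e^{(ρ−s)ℓ}`. [cite: Titchmarsh1986, Thm. 14.20] -/
def zeroTerm (ℓ : ℝ) (s ρ : ℂ) : ℂ :=
  Complex.exp ((ρ - s) * ℓ) * (1 - Complex.exp ((ρ - s) * ℓ)) ^ 2 / ((s - ρ) ^ 3 * (ℓ : ℂ) ^ 2)

/-- The combination of the three `F₀`'s. [folklore] -/
def combF₀ (ℓ : ℝ) (z : ℂ) : ℂ :=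
  fordLaplace₀ (quadPiece ℓ) z - 2 * fordLaplace₀ (quadPiece (2 * ℓ)) z + fordLaplace₀ (quadPiece (3 * ℓ)) z

/-- `F₀^{(ℓ)} − 2F₀^{(2ℓ)} + F₀^{(3ℓ)} = −2e^{−ℓz}(1 − e^{−ℓz})²/z³` (`z ≠ 0`, `ℓ ≥ 0`). [folklore] -/
theorem combF₀_eq {ℓ : ℝ} (hℓ : 0 ≤ ℓ) {z : ℂ} (hz : z ≠ 0) :
    combF₀ ℓ z = -2 * Complex.exp (-(z * ℓ)) * (1 - Complex.exp (-(z * ℓ))) ^ 2 / z ^ 3 := by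
  rw [combF₀, fordLaplace₀_quadPiece hℓ hz, fordLaplace₀_quadPiece (by linarith) hz,
    fordLaplace₀_quadPiece (by linarith) hz]
  have h2 : Complex.exp (-(z * ((2 * ℓ : ℝ) : ℂ))) = Complex.exp (-(z * ℓ)) ^ 2 := by
    rw [sq, ← Complex.exp_add]; congr 1; push_cast; ring
  have h3 : Complex.exp (-(z * ((3 * ℓ : ℝ) : ℂ))) = Complex.exp (-(z * ℓ)) ^ 3 := by
    rw [pow_succ, sq, ← Complex.exp_add, ← Complex.exp_add]; congr 1; push_cast; ring
  rw [h2, h3]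
  push_cast
  field_simp
  ring

/-- `combF₀ ℓ (s − ρ) = −2ℓ² · zeroTerm ℓ s ρ` (`s ≠ ρ`, `ℓ ≥ 0`). [folklore] -/
theorem combF₀_sub_eq {ℓ : ℝ} (hℓ : 0 ≤ ℓ) {s ρ : ℂ} (h : s ≠ ρ) :
    combF₀ ℓ (s - ρ) = -(2 * (ℓ : ℂ) ^ 2) * zeroTerm ℓ s ρ := by
  have hz : s - ρ ≠ 0 := sub_ne_zero.2 h
  rw [combF₀_eq hℓ hz, zeroTerm]
  have he : -((s - ρ) * (ℓ : ℂ)) = (ρ - s) * ℓ := by ring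
  rw [he]
  rcases eq_or_ne ℓ 0 with hℓ0 | hℓ0
  · subst hℓ0; simp
  have hℓC : (ℓ : ℂ) ≠ 0 := Complex.ofReal_ne_zero.2 hℓ0
  field_simp

/-- The remainder `J_x(s) = (J_{g_ℓ}(s) − 2J_{g_{2ℓ}}(s) + J_{g_{3ℓ}}(s))/(2ℓ²)`, each `J_g` the
left-line integral `(1/2π)∫ (−ζ'/ζ)(−1/2+iy) F₀^{(g)}(s + 1/2 − iy) dy` (`smoothedEFRemainder`).
[cite: Titchmarsh1986, Thm. 14.20] -/
def remainder (ℓ : ℝ) (s : ℂ) : ℂ :=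
  (smoothedEFRemainder (quadPiece ℓ) s - 2 * smoothedEFRemainder (quadPiece (2 * ℓ)) s +
    smoothedEFRemainder (quadPiece (3 * ℓ)) s) / (2 * (ℓ : ℂ) ^ 2)

/-! ## The explicit formula -/

/-- **Absolute convergence of the zero sum** `Σ_ρ m(ρ) x^{ρ−s}(1−x^{ρ−s})²/(ℓ²(s−ρ)³)` over the
non-trivial zeros with multiplicity (`0 < ℓ`, `−1/2 < Re s`, `ζ(s) ≠ 0`). [cite: Titchmarsh1986, Thm. 14.20] -/
theorem summable_norm_zeroTerm {ℓ : ℝ} (hℓ : 0 < ℓ) {s : ℂ} (hσ₁ : -(1 / 2) < s.re)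
    (hζs : riemannZeta s ≠ 0) :
    Summable fun ρ : RHWave0.riemannZetaNontrivialZeros ↦
      ‖(riemannZetaZeroOrder (ρ : ℂ) : ℂ) * zeroTerm ℓ s ρ‖ := by
  have h1 := SmoothedEF.summable_norm_zeroTerm (isSmoothedEFTest_quadPiece hℓ.le) hσ₁ hζs
  have h2 := SmoothedEF.summable_norm_zeroTerm (isSmoothedEFTest_quadPiece (a := 2 * ℓ) (by linarith))
    hσ₁ hζs
  have h3 := SmoothedEF.summable_norm_zeroTerm (isSmoothedEFTest_quadPiece (a := 3 * ℓ) (by linarith))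
    hσ₁ hζs
  have hℓ2 : 0 < 2 * ℓ ^ 2 := by positivity
  refine Summable.of_nonneg_of_le (fun _ ↦ norm_nonneg _) (fun ρ ↦ ?_)
    (((h1.add (h2.mul_left 2)).add h3).div_const (2 * ℓ ^ 2))
  have hρ : riemannZeta ρ = 0 := (mem_riemannZetaNontrivialZeros_iff_holds.1 ρ.2).1
  have hne : s ≠ (ρ : ℂ) := fun h ↦ hζs (h ▸ hρ)
  have key : (riemannZetaZeroOrder (ρ : ℂ) : ℂ) * zeroTerm ℓ s ρ =
      -(((riemannZetaZeroOrder (ρ : ℂ) : ℂ) * fordLaplace₀ (quadPiece ℓ) (s - ρ) -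
        2 * ((riemannZetaZeroOrder (ρ : ℂ) : ℂ) * fordLaplace₀ (quadPiece (2 * ℓ)) (s - ρ)) +
        (riemannZetaZeroOrder (ρ : ℂ) : ℂ) * fordLaplace₀ (quadPiece (3 * ℓ)) (s - ρ)) /
        (2 * (ℓ : ℂ) ^ 2)) := by
    have hc := combF₀_sub_eq hℓ.le hne
    rw [combF₀] at hc
    have hℓC : (2 * (ℓ : ℂ) ^ 2) ≠ 0 :=
      mul_ne_zero two_ne_zero (pow_ne_zero _ (Complex.ofReal_ne_zero.2 hℓ.ne'))
    rw [← neg_div, eq_div_iff hℓC]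
    linear_combination (riemannZetaZeroOrder (ρ : ℂ) : ℂ) * hc
  rw [key, norm_neg, norm_div]
  have hn : ‖(2 * (ℓ : ℂ) ^ 2)‖ = 2 * ℓ ^ 2 := by
    rw [norm_mul, Complex.norm_ofNat, norm_pow, Complex.norm_real, Real.norm_eq_abs, abs_of_pos hℓ]
  rw [hn]
  refine div_le_div_of_nonneg_right ?_ hℓ2.le
  calc ‖(riemannZetaZeroOrder (ρ : ℂ) : ℂ) * fordLaplace₀ (quadPiece ℓ) (s - ρ) -
        2 * ((riemannZetaZeroOrder (ρ : ℂ) : ℂ) * fordLaplace₀ (quadPiece (2 * ℓ)) (s - ρ)) +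
        (riemannZetaZeroOrder (ρ : ℂ) : ℂ) * fordLaplace₀ (quadPiece (3 * ℓ)) (s - ρ)‖
      ≤ ‖(riemannZetaZeroOrder (ρ : ℂ) : ℂ) * fordLaplace₀ (quadPiece ℓ) (s - ρ) -
        2 * ((riemannZetaZeroOrder (ρ : ℂ) : ℂ) * fordLaplace₀ (quadPiece (2 * ℓ)) (s - ρ))‖ +
        ‖(riemannZetaZeroOrder (ρ : ℂ) : ℂ) * fordLaplace₀ (quadPiece (3 * ℓ)) (s - ρ)‖ := norm_add_le _ _
    _ ≤ (‖(riemannZetaZeroOrder (ρ : ℂ) : ℂ) * fordLaplace₀ (quadPiece ℓ) (s - ρ)‖ +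
        ‖2 * ((riemannZetaZeroOrder (ρ : ℂ) : ℂ) * fordLaplace₀ (quadPiece (2 * ℓ)) (s - ρ))‖) +
        ‖(riemannZetaZeroOrder (ρ : ℂ) : ℂ) * fordLaplace₀ (quadPiece (3 * ℓ)) (s - ρ)‖ := by
        gcongr; exact norm_sub_le _ _
    _ = _ := by rw [norm_mul (2 : ℂ), Complex.norm_ofNat]

/-- **Selberg's explicit formula for `ζ'/ζ` with the weights `Λ_x`** (Selberg 1946, §2; the
quadratic-kernel analogue is Titchmarsh's Theorem 14.20): for `0 < ℓ` (`x = e^ℓ > 1`),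
`−1/2 < Re s < 3/2`, `s ≠ 1`, `ζ(s) ≠ 0`,
`ζ'/ζ(s) = −Σ_n Λ(n) f_ℓ(log n) n^{−s} − x^{1−s}(1−x^{1−s})²/(ℓ²(s−1)³)`
`        + Σ_ρ m(ρ) x^{ρ−s}(1−x^{ρ−s})²/(ℓ²(s−ρ)³) + J_x(s)`,
the sum over the non-trivial zeros with multiplicity, absolutely convergent
(`summable_norm_zeroTerm`); from the tree's exact smoothed explicit formula of Ford (Lemma 4.5)
applied to `g_ℓ, g_{2ℓ}, g_{3ℓ}`. [cite: Titchmarsh1986, Thm. 14.20] -/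
theorem explicit_formula {ℓ : ℝ} (hℓ : 0 < ℓ) {s : ℂ} (hσ₁ : -(1 / 2) < s.re) (hσ₂ : s.re < 3 / 2)
    (hs1 : s ≠ 1) (hζs : riemannZeta s ≠ 0) :
    deriv riemannZeta s / riemannZeta s =
      -fordK (smoothing ℓ) s - zeroTerm ℓ s 1 +
        ∑' ρ : RHWave0.riemannZetaNontrivialZeros, (riemannZetaZeroOrder (ρ : ℂ) : ℂ) * zeroTerm ℓ s ρ +
        remainder ℓ s := by
  have hT1 := isSmoothedEFTest_quadPiece hℓ.le
  have hT2 := isSmoothedEFTest_quadPiece (a := 2 * ℓ) (by linarith)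
  have hT3 := isSmoothedEFTest_quadPiece (a := 3 * ℓ) (by linarith)
  have h1 := SmoothedEF.fordK_eq_explicit hT1 hσ₁ hσ₂ hs1 hζs
  have h2 := SmoothedEF.fordK_eq_explicit hT2 hσ₁ hσ₂ hs1 hζs
  have h3 := SmoothedEF.fordK_eq_explicit hT3 hσ₁ hσ₂ hs1 hζs
  have hs1' := (SmoothedEF.summable_norm_zeroTerm hT1 hσ₁ hζs).of_norm
  have hs2' := (SmoothedEF.summable_norm_zeroTerm hT2 hσ₁ hζs).of_norm
  have hs3' := (SmoothedEF.summable_norm_zeroTerm hT3 hσ₁ hζs).of_norm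
  have hK := fordK_smoothing_eq hℓ s
  have hℓC : (2 * (ℓ : ℂ) ^ 2) ≠ 0 :=
    mul_ne_zero two_ne_zero (pow_ne_zero _ (Complex.ofReal_ne_zero.2 hℓ.ne'))
  -- the combination of the three zero sums
  set A := ∑' ρ : RHWave0.riemannZetaNontrivialZeros,
    (riemannZetaZeroOrder (ρ : ℂ) : ℂ) * fordLaplace₀ (quadPiece ℓ) (s - ρ) with hA
  set B := ∑' ρ : RHWave0.riemannZetaNontrivialZeros,
    (riemannZetaZeroOrder (ρ : ℂ) : ℂ) * fordLaplace₀ (quadPiece (2 * ℓ)) (s - ρ) with hB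
  set C := ∑' ρ : RHWave0.riemannZetaNontrivialZeros,
    (riemannZetaZeroOrder (ρ : ℂ) : ℂ) * fordLaplace₀ (quadPiece (3 * ℓ)) (s - ρ) with hC
  set S := ∑' ρ : RHWave0.riemannZetaNontrivialZeros,
    (riemannZetaZeroOrder (ρ : ℂ) : ℂ) * zeroTerm ℓ s ρ with hS
  have hzero : A - 2 * B + C = -(2 * (ℓ : ℂ) ^ 2) * S := by
    have e1 : A - 2 * B + C = ∑' ρ : RHWave0.riemannZetaNontrivialZeros,
        ((riemannZetaZeroOrder (ρ : ℂ) : ℂ) * fordLaplace₀ (quadPiece ℓ) (s - ρ) -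
          2 * ((riemannZetaZeroOrder (ρ : ℂ) : ℂ) * fordLaplace₀ (quadPiece (2 * ℓ)) (s - ρ)) +
          (riemannZetaZeroOrder (ρ : ℂ) : ℂ) * fordLaplace₀ (quadPiece (3 * ℓ)) (s - ρ)) := by
      rw [(hs1'.sub (hs2'.mul_left 2)).tsum_add hs3', hs1'.tsum_sub (hs2'.mul_left 2), tsum_mul_left]
    rw [e1, ← tsum_mul_left]
    refine tsum_congr fun ρ ↦ ?_
    have hρ : riemannZeta ρ = 0 := (mem_riemannZetaNontrivialZeros_iff_holds.1 ρ.2).1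
    have hne : s ≠ (ρ : ℂ) := fun h ↦ hζs (h ▸ hρ)
    have hc := combF₀_sub_eq hℓ.le hne
    rw [combF₀] at hc
    linear_combination (riemannZetaZeroOrder (ρ : ℂ) : ℂ) * hc
  have hcomb : fordLaplace₀ (quadPiece ℓ) (s - 1) - 2 * fordLaplace₀ (quadPiece (2 * ℓ)) (s - 1) +
      fordLaplace₀ (quadPiece (3 * ℓ)) (s - 1) = -(2 * (ℓ : ℂ) ^ 2) * zeroTerm ℓ s 1 := by
    have hc := combF₀_sub_eq hℓ.le hs1
    rwa [combF₀] at hc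
  have hrem : smoothedEFRemainder (quadPiece ℓ) s - 2 * smoothedEFRemainder (quadPiece (2 * ℓ)) s +
      smoothedEFRemainder (quadPiece (3 * ℓ)) s = 2 * (ℓ : ℂ) ^ 2 * remainder ℓ s := by
    have hℓ0 : (ℓ : ℂ) ≠ 0 := Complex.ofReal_ne_zero.2 hℓ.ne'
    rw [remainder]; field_simp
  have hg : ((quadPiece ℓ 0 : ℝ) : ℂ) - 2 * ((quadPiece (2 * ℓ) 0 : ℝ) : ℂ) +
      ((quadPiece (3 * ℓ) 0 : ℝ) : ℂ) = 2 * (ℓ : ℂ) ^ 2 := by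
    rw [quadPiece_zero _ hℓ.le, quadPiece_zero _ (by linarith), quadPiece_zero _ (by linarith)]
    push_cast; ring
  refine mul_left_cancel₀ hℓC ?_
  linear_combination hK + h1 - 2 * h2 + h3 - hzero + hcomb + hrem -
    (deriv riemannZeta s / riemannZeta s) * hg

/-! ## The remainder: the left-line integral -/

/-- The remainder is one absolutely convergent integral on the line `Re w = −1/2`:
`J_x(s) = (1/2π)(2ℓ²)⁻¹ ∫_ℝ (−ζ'/ζ)(−1/2+iy) [F₀^{(ℓ)} − 2F₀^{(2ℓ)} + F₀^{(3ℓ)}](s + 1/2 − iy) dy`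
(`−1/2 < Re s`). [folklore] -/
theorem remainder_eq_integral {ℓ : ℝ} (hℓ : 0 < ℓ) {s : ℂ} (hσ₁ : -(1 / 2) < s.re) :
    remainder ℓ s = (1 / (2 * π) : ℂ) / (2 * (ℓ : ℂ) ^ 2) *
      ∫ y : ℝ, -(deriv riemannZeta ((((-(1 / 2) : ℝ)) : ℂ) + y * I) /
          riemannZeta ((((-(1 / 2) : ℝ)) : ℂ) + y * I)) *
        combF₀ ℓ (s - ((((-(1 / 2) : ℝ)) : ℂ) + y * I)) := by
  have hI1 := SmoothedEF.integrable_integrand_left (isSmoothedEFTest_quadPiece hℓ.le) hσ₁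
  have hI2 := SmoothedEF.integrable_integrand_left
    (isSmoothedEFTest_quadPiece (a := 2 * ℓ) (by linarith)) hσ₁
  have hI3 := SmoothedEF.integrable_integrand_left
    (isSmoothedEFTest_quadPiece (a := 3 * ℓ) (by linarith)) hσ₁
  have heq : (fun y : ℝ ↦ -(deriv riemannZeta ((((-(1 / 2) : ℝ)) : ℂ) + y * I) /
          riemannZeta ((((-(1 / 2) : ℝ)) : ℂ) + y * I)) *
        combF₀ ℓ (s - ((((-(1 / 2) : ℝ)) : ℂ) + y * I))) = fun y : ℝ ↦
      smoothedEFIntegrand (quadPiece ℓ) s ((((-(1 / 2) : ℝ)) : ℂ) + y * I) -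
        2 * smoothedEFIntegrand (quadPiece (2 * ℓ)) s ((((-(1 / 2) : ℝ)) : ℂ) + y * I) +
        smoothedEFIntegrand (quadPiece (3 * ℓ)) s ((((-(1 / 2) : ℝ)) : ℂ) + y * I) := by
    funext y
    simp only [smoothedEFIntegrand, combF₀]
    ring
  have h2 : Integrable fun y : ℝ ↦
      2 * smoothedEFIntegrand (quadPiece (2 * ℓ)) s ((((-(1 / 2) : ℝ)) : ℂ) + y * I) := hI2.const_mul 2
  have h12 : Integrable fun y : ℝ ↦
      smoothedEFIntegrand (quadPiece ℓ) s ((((-(1 / 2) : ℝ)) : ℂ) + y * I) -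
        2 * smoothedEFIntegrand (quadPiece (2 * ℓ)) s ((((-(1 / 2) : ℝ)) : ℂ) + y * I) := hI1.sub h2
  rw [heq, integral_add h12 hI3, integral_sub hI1 h2, integral_const_mul]
  simp only [remainder, smoothedEFRemainder]
  ring

/-- Pointwise bound for the combined kernel on the left line: for `Re z ≥ 1`,
`‖−2e^{−zℓ}(1−e^{−zℓ})²/z³‖ ≤ 8e^{−ℓ Re z}/(1/4 + (Im z)²)` (`ℓ ≥ 0`). [folklore] -/
theorem norm_combF₀_le {ℓ : ℝ} (hℓ : 0 ≤ ℓ) {z : ℂ} (hz : 1 ≤ z.re) :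
    ‖combF₀ ℓ z‖ ≤ 8 * Real.exp (-(ℓ * z.re)) / (1 / 4 + z.im ^ 2) := by
  have hz0 : z ≠ 0 := fun h ↦ by rw [h, Complex.zero_re] at hz; linarith
  rw [combF₀_eq hℓ hz0]
  have hexp : ‖Complex.exp (-(z * ℓ))‖ = Real.exp (-(ℓ * z.re)) := by
    rw [Complex.norm_exp]; congr 1; simp [Complex.mul_re]; ring
  have hexp1 : ‖Complex.exp (-(z * ℓ))‖ ≤ 1 := by
    rw [hexp, Real.exp_le_one_iff]; nlinarith
  have h1 : ‖(1 : ℂ) - Complex.exp (-(z * ℓ))‖ ≤ 2 := by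
    refine (norm_sub_le _ _).trans ?_
    rw [norm_one]; linarith
  have hnz : 1 / 4 + z.im ^ 2 ≤ ‖z‖ ^ 2 := by
    rw [Complex.sq_norm, Complex.normSq_apply]; nlinarith
  have hnz1 : 1 ≤ ‖z‖ := hz.trans (Complex.re_le_norm z)
  have hpos : 0 < 1 / 4 + z.im ^ 2 := by positivity
  have hz3 : 1 / 4 + z.im ^ 2 ≤ ‖z‖ ^ 3 := by
    calc 1 / 4 + z.im ^ 2 ≤ ‖z‖ ^ 2 := hnz
      _ = ‖z‖ ^ 2 * 1 := (mul_one _).symm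
      _ ≤ ‖z‖ ^ 2 * ‖z‖ := by gcongr
      _ = ‖z‖ ^ 3 := by ring
  rw [norm_div, norm_mul, norm_mul, norm_neg, norm_pow, norm_pow, Complex.norm_ofNat, hexp]
  rw [div_le_div_iff₀ (by positivity) hpos]
  have hsq : ‖(1 : ℂ) - Complex.exp (-(z * ℓ))‖ ^ 2 ≤ 4 := by nlinarith [norm_nonneg ((1 : ℂ) - Complex.exp (-(z * ℓ)))]
  have he0 : 0 ≤ Real.exp (-(ℓ * z.re)) := (Real.exp_pos _).le
  calc 2 * Real.exp (-(ℓ * z.re)) * ‖(1 : ℂ) - Complex.exp (-(z * ℓ))‖ ^ 2 * (1 / 4 + z.im ^ 2)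
      ≤ 2 * Real.exp (-(ℓ * z.re)) * 4 * ‖z‖ ^ 3 := by
        have := mul_le_mul hsq hz3 hpos.le (by norm_num : (0 : ℝ) ≤ 4)
        nlinarith
    _ = 8 * Real.exp (-(ℓ * z.re)) * ‖z‖ ^ 3 := by ring

/-- **The remainder is small**: there is an absolute constant `C > 0` such that for all `ℓ > 0` and
all `s` with `Re s ≥ 1/2`,
`‖J_x(s)‖ ≤ C (1 + log(1 + |Im s|)) e^{−ℓ(Re s + 1/2)}/ℓ²` (`x = e^ℓ`): the left-line integrand is
`O((1 + log(1+|y|)) x^{−Re s − 1/2}/(ℓ²|s + 1/2 − iy|³))`. [cite: Titchmarsh1986, Thm. 14.20] -/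
theorem norm_remainder_le : ∃ C : ℝ, 0 < C ∧ ∀ ℓ : ℝ, 0 < ℓ → ∀ s : ℂ, 1 / 2 ≤ s.re →
    ‖remainder ℓ s‖ ≤ C * (1 + Real.log (1 + |s.im|)) * Real.exp (-(ℓ * (s.re + 1 / 2))) / ℓ ^ 2 := by
  obtain ⟨C₀, hC₀, hC⟩ := PsiOneExplicit.exists_norm_logDeriv_riemannZeta_left_le
  -- the two absolute constants
  have hint1 : Integrable fun u : ℝ ↦ (1 + 2 * Real.log (1 + |u|)) / (1 / 4 + u ^ 2) :=
    PsiOneExplicit.integrable_left_majorant zero_le_one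
  have hint0 : Integrable fun u : ℝ ↦ (0 + 2 * Real.log (1 + |u|)) / (1 / 4 + u ^ 2) :=
    PsiOneExplicit.integrable_left_majorant le_rfl
  have hintK : Integrable fun u : ℝ ↦ (1 / 4 + u ^ 2)⁻¹ := by
    refine hint1.mono' (by fun_prop) (ae_of_all _ fun u ↦ ?_)
    have hl : 0 ≤ Real.log (1 + |u|) := Real.log_nonneg (by linarith [abs_nonneg u])
    rw [Real.norm_eq_abs, abs_of_nonneg (by positivity), inv_eq_one_div]
    exact div_le_div_of_nonneg_right (by linarith) (by positivity)
  set K₁ : ℝ := ∫ u : ℝ, (1 / 4 + u ^ 2)⁻¹ with hK₁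
  set K₂ : ℝ := ∫ u : ℝ, (0 + 2 * Real.log (1 + |u|)) / (1 / 4 + u ^ 2) with hK₂
  have hK₁0 : 0 ≤ K₁ := integral_nonneg fun u ↦ by positivity
  have hK₂0 : 0 ≤ K₂ := integral_nonneg fun u ↦ by
    have hl : 0 ≤ Real.log (1 + |u|) := Real.log_nonneg (by linarith [abs_nonneg u])
    positivity
  refine ⟨2 / π * (C₀ * K₁ + K₂ + 2 * K₁) + 1, by positivity, fun ℓ hℓ s hσ ↦ ?_⟩
  have hσ₁ : -(1 / 2) < s.re := by linarith
  set t := s.im with ht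
  set a := s.re + 1 / 2 with ha
  have ha1 : 1 ≤ a := by rw [ha]; linarith
  set A : ℝ := C₀ + 2 * Real.log (1 + |t|) with hA
  have hlogt : 0 ≤ Real.log (1 + |t|) := Real.log_nonneg (by linarith [abs_nonneg t])
  have hA0 : 0 ≤ A := by positivity
  -- the majorant and its integral
  set g : ℝ → ℝ := fun y ↦ 8 * Real.exp (-(ℓ * a)) *
    ((A + 2 * Real.log (1 + |y - t|)) / (1 / 4 + (y - t) ^ 2)) with hg
  have hgi : Integrable g :=
    ((PsiOneExplicit.integrable_left_majorant hA0).comp_sub_right t).const_mul _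
  have hgint : ∫ y, g y = 8 * Real.exp (-(ℓ * a)) * (A * K₁ + K₂) := by
    rw [hg, integral_const_mul]
    congr 1
    have htr := integral_sub_right_eq_self (μ := volume)
      (fun u : ℝ ↦ (A + 2 * Real.log (1 + |u|)) / (1 / 4 + u ^ 2)) t
    rw [htr]
    have hsplit : (fun u : ℝ ↦ (A + 2 * Real.log (1 + |u|)) / (1 / 4 + u ^ 2)) = fun u : ℝ ↦
        A * (1 / 4 + u ^ 2)⁻¹ + (0 + 2 * Real.log (1 + |u|)) / (1 / 4 + u ^ 2) := by
      funext u; field_simp; ring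
    rw [hsplit, integral_add (hintK.const_mul A) hint0, integral_const_mul]
  -- pointwise bound of the integrand
  have hpt : ∀ y : ℝ, ‖-(deriv riemannZeta ((((-(1 / 2) : ℝ)) : ℂ) + y * I) /
          riemannZeta ((((-(1 / 2) : ℝ)) : ℂ) + y * I)) *
        combF₀ ℓ (s - ((((-(1 / 2) : ℝ)) : ℂ) + y * I))‖ ≤ g y := by
    intro y
    set w : ℂ := (((-(1 / 2) : ℝ)) : ℂ) + y * I with hw
    have hzre : (s - w).re = a := by simp [hw, ha]
    have hzim : (s - w).im = t - y := by simp [hw, ht]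
    have hcomb := norm_combF₀_le hℓ.le (z := s - w) (by rw [hzre]; exact ha1)
    rw [hzre, hzim] at hcomb
    rw [norm_mul, norm_neg, hg]
    have hζb := hC y
    have hlogy : Real.log (1 + |y|) ≤ Real.log (1 + |t|) + Real.log (1 + |y - t|) :=
      SmoothedEF.log_one_add_abs_le_add y t
    have hlog2 : 0 ≤ Real.log (1 + |y - t|) := Real.log_nonneg (by linarith [abs_nonneg (y - t)])
    have hnum : C₀ + 2 * Real.log (1 + |y|) ≤ A + 2 * Real.log (1 + |y - t|) := by
      rw [hA]; linarith
    have hden : (t - y) ^ 2 = (y - t) ^ 2 := by ring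
    rw [hden] at hcomb
    have hpos : 0 < 1 / 4 + (y - t) ^ 2 := by positivity
    calc ‖deriv riemannZeta w / riemannZeta w‖ * ‖combF₀ ℓ (s - w)‖
        ≤ (A + 2 * Real.log (1 + |y - t|)) * (8 * Real.exp (-(ℓ * a)) / (1 / 4 + (y - t) ^ 2)) :=
          mul_le_mul (hζb.trans hnum) hcomb (norm_nonneg _) (by positivity)
      _ = 8 * Real.exp (-(ℓ * a)) * ((A + 2 * Real.log (1 + |y - t|)) / (1 / 4 + (y - t) ^ 2)) := by
          ring
  -- assemble
  rw [remainder_eq_integral hℓ hσ₁, norm_mul, norm_div]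
  have hn1 : ‖(1 / (2 * π) : ℂ)‖ = 1 / (2 * π) := by
    rw [show (1 / (2 * π) : ℂ) = ((1 / (2 * π) : ℝ) : ℂ) by push_cast; ring, Complex.norm_real,
      Real.norm_eq_abs, abs_of_pos (by positivity)]
  have hn2 : ‖(2 * (ℓ : ℂ) ^ 2)‖ = 2 * ℓ ^ 2 := by
    rw [norm_mul, Complex.norm_ofNat, norm_pow, Complex.norm_real, Real.norm_eq_abs, abs_of_pos hℓ]
  rw [hn1, hn2]
  have hI := (norm_integral_le_of_norm_le hgi (ae_of_all _ hpt)).trans_eq hgint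
  have hℓ2 : 0 < ℓ ^ 2 := by positivity
  calc 1 / (2 * π) / (2 * ℓ ^ 2) * ‖∫ y : ℝ, -(deriv riemannZeta ((((-(1 / 2) : ℝ)) : ℂ) + y * I) /
          riemannZeta ((((-(1 / 2) : ℝ)) : ℂ) + y * I)) * combF₀ ℓ (s - ((((-(1 / 2) : ℝ)) : ℂ) + y * I))‖
      ≤ 1 / (2 * π) / (2 * ℓ ^ 2) * (8 * Real.exp (-(ℓ * a)) * (A * K₁ + K₂)) :=
        mul_le_mul_of_nonneg_left hI (by positivity)
    _ = 2 / π * ((C₀ + 2 * Real.log (1 + |t|)) * K₁ + K₂) * Real.exp (-(ℓ * a)) / ℓ ^ 2 := by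
        rw [hA]; field_simp; ring
    _ ≤ 2 / π * ((C₀ * K₁ + K₂ + 2 * K₁) * (1 + Real.log (1 + |t|))) * Real.exp (-(ℓ * a)) / ℓ ^ 2 := by
        gcongr
        nlinarith [mul_nonneg hC₀.le hK₁0, mul_nonneg hK₁0 hlogt]
    _ ≤ (2 / π * (C₀ * K₁ + K₂ + 2 * K₁) + 1) * (1 + Real.log (1 + |t|)) * Real.exp (-(ℓ * a)) / ℓ ^ 2 := by
        refine div_le_div_of_nonneg_right (mul_le_mul_of_nonneg_right ?_ (Real.exp_pos _).le) hℓ2.le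
        nlinarith [show 0 ≤ 2 / π * (C₀ * K₁ + K₂ + 2 * K₁) by positivity]

/-! ## To the right of `Re s = 1`: `ζ'/ζ(s) + K_{f_ℓ}(s) = −Σ_{n > x} Λ(n)(1 − f_ℓ(log n)) n^{−s}` -/

/-- `Σ_n Λ(n) n^{−σ₀} < ∞` for real `σ₀ > 1` (the Dirichlet series of `−ζ'/ζ`). [folklore] -/
theorem summable_vonMangoldt_mul_rpow {σ₀ : ℝ} (hσ₀ : 1 < σ₀) :
    Summable fun n : ℕ ↦ (ArithmeticFunction.vonMangoldt n : ℝ) * (n : ℝ) ^ (-σ₀) := by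
  have h := (ArithmeticFunction.LSeriesSummable_vonMangoldt (s := (σ₀ : ℂ))
    (by simpa using hσ₀)).norm
  refine h.congr fun n ↦ ?_
  rcases Nat.eq_zero_or_pos n with rfl | hn
  · simp
  rw [LSeries.term_def₀ (by simp) (σ₀ : ℂ) n, norm_mul, Complex.norm_real, Real.norm_eq_abs,
    abs_of_nonneg ArithmeticFunction.vonMangoldt_nonneg,
    show (-(σ₀ : ℂ)) = ((-σ₀ : ℝ) : ℂ) by push_cast; ring,
    Complex.norm_natCast_cpow_of_pos hn, Complex.ofReal_re]

/-- **`ζ'/ζ + K_{f_ℓ}` to the right of `1`**: for `1 < σ₀ ≤ Re s` and `0 < ℓ`,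
`‖ζ'/ζ(s) + Σ_n Λ(n) f_ℓ(log n) n^{−s}‖ ≤ e^{−ℓ(Re s − σ₀)} Σ_n Λ(n) n^{−σ₀}`, since
`ζ'/ζ(s) = −Σ Λ(n) n^{−s}`, `f_ℓ(log n) = 1` for `n ≤ x = e^ℓ` and `0 ≤ f_ℓ ≤ 1`. [folklore] -/
theorem norm_logDeriv_add_fordK_le {ℓ σ₀ : ℝ} (hℓ : 0 < ℓ) (hσ₀ : 1 < σ₀) {s : ℂ} (hs : σ₀ ≤ s.re) :
    ‖deriv riemannZeta s / riemannZeta s + fordK (smoothing ℓ) s‖ ≤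
      Real.exp (-(ℓ * (s.re - σ₀))) *
        ∑' n : ℕ, (ArithmeticFunction.vonMangoldt n : ℝ) * (n : ℝ) ^ (-σ₀) := by
  have hs1 : 1 < s.re := hσ₀.trans_le hs
  have hL := ArithmeticFunction.LSeries_vonMangoldt_eq_deriv_riemannZeta_div hs1
  have hLs : Summable fun n : ℕ ↦ LSeries.term (fun n ↦ (ArithmeticFunction.vonMangoldt n : ℂ)) s n :=
    ArithmeticFunction.LSeriesSummable_vonMangoldt hs1
  have hterm : ∀ n : ℕ, LSeries.term (fun n ↦ (ArithmeticFunction.vonMangoldt n : ℂ)) s n =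
      (ArithmeticFunction.vonMangoldt n : ℂ) * (n : ℂ) ^ (-s) := fun n ↦
    LSeries.term_def₀ (by simp) s n
  -- the terms of `K_f` and of the difference
  set g : ℕ → ℂ := fun n ↦ ((ArithmeticFunction.vonMangoldt n : ℝ) : ℂ) *
    (smoothing ℓ (Real.log n) : ℂ) * (n : ℂ) ^ (-s) with hg
  set d : ℕ → ℂ := fun n ↦ ((ArithmeticFunction.vonMangoldt n : ℝ) : ℂ) *
    (1 - (smoothing ℓ (Real.log n) : ℂ)) * (n : ℂ) ^ (-s) with hd
  -- pointwise bound for `d`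
  have hbound : ∀ n : ℕ, ‖d n‖ ≤ Real.exp (-(ℓ * (s.re - σ₀))) *
      ((ArithmeticFunction.vonMangoldt n : ℝ) * (n : ℝ) ^ (-σ₀)) := by
    intro n
    rcases Nat.eq_zero_or_pos n with rfl | hn
    · simp [hd]
    have hn' : (0 : ℝ) < n := by exact_mod_cast hn
    have hΛ : 0 ≤ (ArithmeticFunction.vonMangoldt n : ℝ) := ArithmeticFunction.vonMangoldt_nonneg
    rw [hd]
    simp only
    rw [norm_mul, norm_mul, Complex.norm_real, Real.norm_eq_abs, abs_of_nonneg hΛ,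
      Complex.norm_natCast_cpow_of_pos hn, Complex.neg_re]
    rcases le_or_gt (Real.log n) ℓ with hle | hlt
    · rw [smoothing_eq_one hℓ hle]
      simp only [Complex.ofReal_one, sub_self, norm_zero, mul_zero, zero_mul]
      positivity
    · have h1 : ‖(1 : ℂ) - (smoothing ℓ (Real.log n) : ℂ)‖ ≤ 1 := by
        rw [show (1 : ℂ) - (smoothing ℓ (Real.log n) : ℂ) = ((1 - smoothing ℓ (Real.log n) : ℝ) : ℂ) by
          push_cast; ring, Complex.norm_real, Real.norm_eq_abs, abs_le]
        constructor <;> linarith [smoothing_nonneg hℓ (Real.log n), smoothing_le_one hℓ (Real.log n)]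
      have h2 : (n : ℝ) ^ (-s.re) ≤ Real.exp (-(ℓ * (s.re - σ₀))) * (n : ℝ) ^ (-σ₀) := by
        rw [show (-s.re) = (-(s.re - σ₀)) + (-σ₀) by ring, Real.rpow_add hn']
        refine mul_le_mul_of_nonneg_right ?_ (Real.rpow_nonneg hn'.le _)
        rw [Real.rpow_def_of_pos hn', Real.exp_le_exp]
        nlinarith
      calc (ArithmeticFunction.vonMangoldt n : ℝ) * ‖(1 : ℂ) - (smoothing ℓ (Real.log n) : ℂ)‖ * (n : ℝ) ^ (-s.re)
          ≤ (ArithmeticFunction.vonMangoldt n : ℝ) * 1 * (Real.exp (-(ℓ * (s.re - σ₀))) * (n : ℝ) ^ (-σ₀)) :=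
            mul_le_mul (mul_le_mul_of_nonneg_left h1 hΛ) h2 (Real.rpow_nonneg hn'.le _) (by positivity)
        _ = _ := by ring
  have hBsum := summable_vonMangoldt_mul_rpow hσ₀
  have hdsum : Summable d := Summable.of_norm_bounded (hBsum.mul_left _) hbound
  -- `K_f` is summable with sum `fordK`
  have hgsum : Summable g := by
    refine Summable.of_norm_bounded hLs.norm fun n ↦ ?_
    rw [hterm n, hg]
    simp only
    rw [norm_mul, norm_mul, norm_mul]
    refine mul_le_mul_of_nonneg_right ?_ (norm_nonneg _)
    rw [Complex.norm_real, Complex.norm_real, Real.norm_eq_abs, Real.norm_eq_abs,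
      abs_of_nonneg ArithmeticFunction.vonMangoldt_nonneg]
    exact mul_le_of_le_one_right ArithmeticFunction.vonMangoldt_nonneg (abs_smoothing_le_one hℓ _)
  -- the identity
  have hid : deriv riemannZeta s / riemannZeta s + fordK (smoothing ℓ) s = -∑' n, d n := by
    have e1 : deriv riemannZeta s / riemannZeta s = -∑' n, LSeries.term
        (fun n ↦ (ArithmeticFunction.vonMangoldt n : ℂ)) s n := by
      rw [← LSeries, hL]; ring
    have e2 : fordK (smoothing ℓ) s = ∑' n, g n := rfl
    have e3 : ∑' n, d n = ∑' n, LSeries.term (fun n ↦ (ArithmeticFunction.vonMangoldt n : ℂ)) s n -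
        ∑' n, g n := by
      rw [← hLs.tsum_sub hgsum]
      refine tsum_congr fun n ↦ ?_
      rw [hterm n, hg, hd]
      simp only
      ring
    rw [e1, e2, e3]
    ring
  rw [hid, norm_neg]
  exact tsum_of_norm_bounded (hBsum.hasSum.mul_left _) hbound

end SelbergExplicit

end Literature.NumberTheory.LFunctions
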